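import Summits.ABC.StewartYu.DescentStepQ
import HarnessLib

/-!
# Cell abc-stewartyu, WP-A3 (vi): integrality of the signed cores and Siegel's lemma, sign-free

`Summits/ABC/StewartYu/DescentIntegralityQ.lean` — cell `abc-stewartyu` (HOME
`run/shared/lean/pub/abc-stewartyu/`, seat p3; the "copy-port" of `HOME/plan/PORT-MAP.md`
§0-ERRATUM, concluded; theorems only, no named fact), sequel to `DescentStepQ.lean`.

On `Q : SetupQ` with the clearing denominators of the flattening (`Q.flat.Dclear`, `Q.flat.Dhalf`:
they involve only `ν`, `|b_θ|` and the denominators `den |αⱼ| = den αⱼ`):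

* `exists_int_qE`, `exists_int_Dclear_mul_qTerm` — the cleared SIGNED coefficients of the level-`0`
  equations are integers (the tree's `CW77.Setup.exists_int_qE`, `exists_int_Dclear_mul_qTerm`);
* `siegel_step` — **Step 1**: Siegel's lemma (Mathlib `Int.Matrix.exists_ne_zero_int_vec_norm_le`)
  produces the invariant `SetupQ.Inv` at level `0` from a count of unknowns vs equations and a bound
  `Amax` on the cleared coefficients (the tree's `CW77.Setup.siegel_step`
  [cite: CijsouwWaldschmidt1977, §4 Step 1 (pp. 185–186)], proof verbatim); since
  `|qTerm| = |qTerm♭|` (`SetupQ.abs_qTerm`) the bound is supplied by the tree's archimedean size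
  estimates (`Waldschmidt1980Sizes*`) applied to `Q.flat`;
* `exists_int_qEh`, `exists_int_Dhalf_mul_rHalf`, `exists_int_Dhalf_mul_classVec` — integrality of the
  cleared signed class sums at the half points (the input of the `p`-adic Liouville inequality).

Everything is [folklore]; proof texts are the tree's with `α_pos ↦ α_ne`.
-/

noncomputable section

open Finset
open Literature.NumberTheory.Transcendental
open Literature.NumberTheory.Transcendental.Baker1975.Ch3 (nuBound nuBound_pos)
open Literature.NumberTheory.Transcendental.CW77
open Literature.NumberTheory.Transcendental.CW77.Setup (Idx Tau tauNorm scale tauSet mem_tauSet)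

namespace Summit.ABC.StewartYu

attribute [local instance] Matrix.seminormedAddCommGroup

namespace SetupQ

variable (Q : SetupQ) {h Lb : ℕ}

/-- `den |αⱼ| = den αⱼ`. [folklore] -/
@[simp] theorem flat_α_den (j : Fin Q.d) : (Q.flat.α j).den = (Q.α j).den := Rat.den_abs_eq_den _

/-- `den |θ| = den θ`. [folklore] -/
@[simp] theorem flat_θ_den : Q.flat.θ.den = Q.θ.den := Rat.den_abs_eq_den _

/-! ### Integrality at the natural points -/

/-- `(∏ den αⱼ^{Lⱼ s}) den θ^{L_θ s} · qE ∈ ℤ` on the box (`λⱼ ≤ Lⱼ`, `λ_θ ≤ L_θ`). [folklore] -/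
theorem exists_int_qE {L : Fin Q.d → ℕ} {Lθ : ℕ} {u : Idx Q.d h Lb} (hu : (∀ j, u.2.1 j ≤ L j) ∧ u.2.2 ≤ Lθ)
    (s : ℕ) : ∃ z : ℤ, (((∏ j, (Q.α j).den ^ (L j * s)) * Q.θ.den ^ (Lθ * s) : ℕ) : ℚ) * Q.qE u s = z := by
  unfold qE
  -- `den^{L s} α^{λ s} = den^{(L-λ) s} · num^{λ s}`
  have hone : ∀ (q : ℚ) (lam Lq : ℕ), lam ≤ Lq → ∃ z : ℤ, ((q.den ^ (Lq * s) : ℕ) : ℚ) * q ^ (lam * s) = z := by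
    intro q lam Lq hle
    refine ⟨(q.den : ℤ) ^ ((Lq - lam) * s) * q.num ^ (lam * s), ?_⟩
    have hsplit : Lq * s = (Lq - lam) * s + lam * s := by rw [← add_mul, Nat.sub_add_cancel hle]
    rw [hsplit, pow_add]
    push_cast
    rw [mul_assoc, ← mul_pow, Rat.den_mul_eq_num]
  choose zα hzα using fun j => hone (Q.α j) (u.2.1 j) (L j) (hu.1 j)
  obtain ⟨zθ, hzθ⟩ := hone Q.θ u.2.2 Lθ hu.2
  refine ⟨(∏ j, zα j) * zθ, ?_⟩
  have hα' : ∏ j, ((((Q.α j).den : ℚ)) ^ (L j * s) * (Q.α j) ^ (u.2.1 j * s)) = ∏ j, (zα j : ℚ) :=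
    prod_congr rfl fun j _ => by exact_mod_cast hzα j
  push_cast at hzθ ⊢
  calc (∏ j, (((Q.α j).den : ℚ)) ^ (L j * s)) * ((Q.θ.den : ℚ)) ^ (Lθ * s) *
        ((∏ j, Q.α j ^ (u.2.1 j * s)) * Q.θ ^ (u.2.2 * s))
      = (∏ j, ((((Q.α j).den : ℚ)) ^ (L j * s) * (Q.α j) ^ (u.2.1 j * s))) *
          (((Q.θ.den : ℚ)) ^ (Lθ * s) * Q.θ ^ (u.2.2 * s)) := by rw [prod_mul_distrib]; ring
    _ = (∏ j, (zα j : ℚ)) * (zθ : ℚ) := by rw [hα', hzθ]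

/-- The denominator part of `Dclear♭` is that of the signed generators. [folklore] -/
theorem flat_Dclear_eq (J₀ : ℕ) (L : Fin Q.d → ℕ) (Lθ : ℕ) (s : ℕ) (τ : Tau Q.d) :
    Q.flat.Dclear (h := h) J₀ L Lθ s τ =
      nuBound (scale J₀ 0 * s) h ^ τ.1 * Q.bθ.natAbs ^ (∑ j, τ.2 j) *
        ((∏ j, (Q.α j).den ^ (L j * s)) * Q.θ.den ^ (Lθ * s)) := by
  unfold CW77.Setup.Dclear
  simp only [Rat.den_abs_eq_den]

/-- **The cleared signed coefficients are integers**: `Dclear♭(s,τ) · qTerm ∈ ℤ` on the box of level `0`.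
[folklore] -/
theorem exists_int_Dclear_mul_qTerm (J₀ : ℕ) {L : Fin Q.d → ℕ} {Lθ : ℕ} {u : Idx Q.d h Lb}
    (hu : u ∈ Q.flat.box (h := h) (Lb := Lb) L Lθ 0) (τ : Tau Q.d) (s : ℕ) :
    ∃ z : ℤ, ((Q.flat.Dclear (h := h) J₀ L Lθ s τ : ℕ) : ℚ) * Q.qTerm J₀ 0 u τ s = z := by
  rw [Q.flat.mem_box] at hu
  simp only [pow_zero, Nat.div_one] at hu
  obtain ⟨z₁, hz₁⟩ := Q.flat.exists_int_qΔ J₀ 0 u τ.1 s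
  obtain ⟨z₂, hz₂⟩ := Q.flat.exists_int_qA u τ.2
  obtain ⟨z₃, hz₃⟩ := Q.exists_int_qE hu s
  refine ⟨z₁ * z₂ * z₃, ?_⟩
  rw [Q.flat_Dclear_eq]
  unfold qTerm
  push_cast at hz₁ hz₂ hz₃ ⊢
  rw [← hz₁, ← hz₂, ← hz₃]; ring

/-! ### Step 1: Siegel's lemma -/

/-- **Step 1 (Siegel's lemma), sign-free.** If there are more than twice as many unknowns in the box of
level `0` as equations `(s, τ)` (`s < S₀`, `|τ| < T`, `S₀, T ≥ 1`), and the cleared signed coefficients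
are bounded by `Amax ≥ 1`, then there are integers `p(u)`, not all zero, supported in the box, bounded
by `#box · Amax`, satisfying all the relations of level `0`: the invariant `SetupQ.Inv` at `J = 0`.
[folklore] -/
theorem siegel_step (J₀ : ℕ) (L : Fin Q.d → ℕ) (Lθ S₀ T : ℕ) (hS₀ : 1 ≤ S₀) (hT : 1 ≤ T)
    (hcard : 2 * ((range S₀) ×ˢ tauSet Q.d T).card ≤ (Q.flat.box (h := h) (Lb := Lb) L Lθ 0).card)
    {Amax : ℝ} (hAmax : 1 ≤ Amax)
    (hA : ∀ s, s < S₀ → ∀ τ : Tau Q.d, tauNorm τ < T → ∀ u ∈ Q.flat.box (h := h) (Lb := Lb) L Lθ 0,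
      |((Q.flat.Dclear (h := h) J₀ L Lθ s τ : ℕ) : ℝ) * (Q.qTerm J₀ 0 u τ s : ℝ)| ≤ Amax) :
    ∃ p : Idx Q.d h Lb → ℤ,
      Q.Inv J₀ L Lθ S₀ T ⌈((Q.flat.box (h := h) (Lb := Lb) L Lθ 0).card : ℝ) * Amax⌉ 0 p := by
  classical
  set boxZ := Q.flat.box (h := h) (Lb := Lb) L Lθ 0 with hboxZ
  set eqs := (range S₀) ×ˢ tauSet Q.d T with heqs
  -- the integer matrix
  have hint : ∀ (e : eqs) (u : boxZ), ∃ z : ℤ,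
      ((Q.flat.Dclear (h := h) J₀ L Lθ e.1.1 e.1.2 : ℕ) : ℚ) * Q.qTerm J₀ 0 u.1 e.1.2 e.1.1 = z :=
    fun e u => Q.exists_int_Dclear_mul_qTerm J₀ u.2 e.1.2 e.1.1
  choose Az hAz using hint
  set A : Matrix eqs boxZ ℤ := Matrix.of fun e u => Az e u with hAdef
  -- cardinalities
  have hm : 0 < Fintype.card eqs := by
    rw [Fintype.card_coe]
    refine Finset.card_pos.mpr ⟨(0, ((0 : ℕ), (0 : Fin Q.d → ℕ))), ?_⟩
    rw [heqs, mem_product, mem_range, mem_tauSet]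
    unfold tauNorm
    simpa using ⟨hS₀, hT⟩
  have hn : Fintype.card eqs < Fintype.card boxZ := by
    rw [Fintype.card_coe, Fintype.card_coe]
    have : 0 < eqs.card := by rwa [Fintype.card_coe] at hm
    omega
  obtain ⟨t, ht0, hAt, htnorm⟩ := Int.Matrix.exists_ne_zero_int_vec_norm_le A hn hm
  -- entries of `A` are bounded by `Amax`, hence `‖t‖ ≤ #box · Amax`
  have hAnorm : ‖A‖ ≤ Amax := by
    rw [Matrix.norm_le_iff (by linarith)]
    intro e u
    have h1 := hAz e u
    have hmem : (e : ℕ × Tau Q.d) ∈ range S₀ ×ˢ tauSet Q.d T := e.2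
    rw [mem_product, mem_range, mem_tauSet] at hmem
    have h2 := hA e.1.1 hmem.1 e.1.2 hmem.2 u.1 u.2
    have hcast : ((Q.flat.Dclear (h := h) J₀ L Lθ e.1.1 e.1.2 : ℕ) : ℝ) * (Q.qTerm J₀ 0 u.1 e.1.2 e.1.1 : ℝ) =
        ((Az e u : ℤ) : ℝ) := by
      have := congrArg (fun q : ℚ => (q : ℝ)) h1
      push_cast at this
      exact this
    rw [hAdef, Matrix.of_apply, Int.norm_eq_abs]
    rwa [hcast] at h2
  have htle : ∀ u : boxZ, |(t u : ℝ)| ≤ (boxZ.card : ℝ) * Amax := by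
    intro u
    have h1 : ‖t u‖ ≤ ‖t‖ := norm_le_pi_norm t u
    rw [Int.norm_eq_abs] at h1
    refine h1.trans (htnorm.trans ?_)
    have hbase : (1 : ℝ) ≤ (Fintype.card boxZ : ℝ) * max 1 ‖A‖ := by
      have : (1 : ℝ) ≤ Fintype.card boxZ := by exact_mod_cast (show 1 ≤ Fintype.card boxZ by omega)
      nlinarith [le_max_left (1 : ℝ) ‖A‖]
    have hexp : (Fintype.card eqs : ℝ) / (Fintype.card boxZ - Fintype.card eqs) ≤ 1 := by
      rw [div_le_one (by rw [sub_pos]; exact_mod_cast hn)]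
      have : 2 * (Fintype.card eqs : ℝ) ≤ Fintype.card boxZ := by
        rw [Fintype.card_coe, Fintype.card_coe]; exact_mod_cast hcard
      linarith
    calc ((Fintype.card boxZ : ℝ) * max 1 ‖A‖) ^ ((Fintype.card eqs : ℝ) / (Fintype.card boxZ - Fintype.card eqs))
        ≤ ((Fintype.card boxZ : ℝ) * max 1 ‖A‖) ^ (1 : ℝ) :=
          Real.rpow_le_rpow_of_exponent_le hbase hexp
      _ = (Fintype.card boxZ : ℝ) * max 1 ‖A‖ := Real.rpow_one _
      _ ≤ (boxZ.card : ℝ) * Amax := by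
          rw [Fintype.card_coe]
          exact mul_le_mul_of_nonneg_left (max_le hAmax hAnorm) (by positivity)
  -- the vector `p`
  set p : Idx Q.d h Lb → ℤ := fun u => if hu : u ∈ boxZ then t ⟨u, hu⟩ else 0 with hp
  have hp_mem : ∀ u (hu : u ∈ boxZ), p u = t ⟨u, hu⟩ := fun u hu => by simp only [hp, dif_pos hu]
  refine ⟨p, ⟨?_, ?_, ?_, ?_⟩⟩
  · -- support
    intro u hu
    by_contra hnot
    exact hu (dif_neg hnot)
  · -- not all zero
    obtain ⟨u, hu⟩ := Function.ne_iff.mp ht0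
    refine ⟨u.1, ?_⟩
    rw [hp_mem u.1 u.2]; exact hu
  · -- bound
    intro u
    by_cases hu : u ∈ boxZ
    · rw [hp_mem u hu]
      have h1 := htle ⟨u, hu⟩
      have h2 : ((t ⟨u, hu⟩ : ℤ) : ℝ) ≤ ⌈(boxZ.card : ℝ) * Amax⌉ :=
        (le_abs_self _).trans (h1.trans (Int.le_ceil _))
      have h3 : (-(t ⟨u, hu⟩ : ℤ) : ℝ) ≤ ⌈(boxZ.card : ℝ) * Amax⌉ :=
        (neg_le_abs _).trans (h1.trans (Int.le_ceil _))
      rw [abs_le]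
      constructor
      · have : -(⌈(boxZ.card : ℝ) * Amax⌉ : ℤ) ≤ t ⟨u, hu⟩ := by
          exact_mod_cast (by linarith : (-(⌈(boxZ.card : ℝ) * Amax⌉ : ℤ) : ℝ) ≤ t ⟨u, hu⟩)
        exact this
      · exact_mod_cast h2
    · simp only [hp, dif_neg hu, abs_zero]
      exact Int.ceil_nonneg (by positivity)
  · -- relations
    intro s hs _hodd τ hτ
    rw [pow_zero, one_mul] at hs
    rw [pow_zero, Nat.div_one] at hτ
    have hmem : (s, τ) ∈ eqs := by
      rw [heqs, mem_product, mem_range, mem_tauSet]; exact ⟨hs, hτ⟩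
    have hrow := congrFun hAt ⟨(s, τ), hmem⟩
    simp only [Matrix.mulVec, dotProduct, Pi.zero_apply] at hrow
    -- cast to `ℚ` and insert the coefficients
    have hD : ((Q.flat.Dclear (h := h) J₀ L Lθ s τ : ℕ) : ℚ) ≠ 0 := by
      exact_mod_cast (Q.flat.Dclear_pos J₀ L Lθ s τ).ne'
    have hsum : ((Q.flat.Dclear (h := h) J₀ L Lθ s τ : ℕ) : ℚ) * Q.coreSum J₀ 0 boxZ p τ s =
        ((∑ u : boxZ, A ⟨(s, τ), hmem⟩ u * t u : ℤ) : ℚ) := by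
      unfold coreSum
      rw [mul_sum, ← Finset.sum_coe_sort boxZ]
      push_cast
      refine sum_congr rfl fun u _ => ?_
      rw [hAdef, Matrix.of_apply, ← hAz ⟨(s, τ), hmem⟩ u, hp_mem u.1 u.2]
      simp only; ring
    rw [hrow] at hsum
    simp only [Int.cast_zero, mul_eq_zero] at hsum
    exact hsum.resolve_left hD

/-! ### Integrality at the half points -/

/-- `(∏ den αⱼ^{⌊Lⱼ/2^J⌋ s}) den θ^{⌊L_θ/2^J⌋ s} · qEh ∈ ℤ` on the box of level `J` (signed). [folklore] -/
theorem exists_int_qEh {L : Fin Q.d → ℕ} {Lθ J : ℕ} {u : Idx Q.d h Lb}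
    (hu : u ∈ Q.flat.box (h := h) (Lb := Lb) L Lθ J) (s : ℕ) :
    ∃ z : ℤ, (((∏ j, (Q.α j).den ^ (L j / 2 ^ J * s)) * Q.θ.den ^ (Lθ / 2 ^ J * s) : ℕ) : ℚ) * Q.qEh u s = z := by
  rw [Q.flat.mem_box] at hu
  have hone : ∀ (q : ℚ) (e Lq : ℕ), e ≤ Lq * s → ∃ z : ℤ, ((q.den ^ (Lq * s) : ℕ) : ℚ) * q ^ e = z := by
    intro q e Lq hle
    refine ⟨(q.den : ℤ) ^ (Lq * s - e) * q.num ^ e, ?_⟩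
    have hsplit : Lq * s = (Lq * s - e) + e := (Nat.sub_add_cancel hle).symm
    rw [hsplit, pow_add]
    push_cast
    rw [mul_assoc, ← mul_pow, Rat.den_mul_eq_num]
    congr 2; omega
  have hlam : ∀ j, Q.flat.expn u s (Fin.castSucc j) / 2 ≤ L j / 2 ^ J * s := by
    intro j
    rw [Q.flat_expn_castSucc]
    calc u.2.1 j * s / 2 ≤ u.2.1 j * s := Nat.div_le_self _ _
      _ ≤ L j / 2 ^ J * s := Nat.mul_le_mul_right _ (hu.1 j)
  have hθ' : Q.flat.expn u s (Fin.last Q.d) / 2 ≤ Lθ / 2 ^ J * s := by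
    rw [Q.flat_expn_last]
    calc u.2.2 * s / 2 ≤ u.2.2 * s := Nat.div_le_self _ _
      _ ≤ Lθ / 2 ^ J * s := Nat.mul_le_mul_right _ hu.2
  choose zα hzα using fun j => hone (Q.α j) _ (L j / 2 ^ J) (hlam j)
  obtain ⟨zθ, hzθ⟩ := hone Q.θ _ (Lθ / 2 ^ J) hθ'
  refine ⟨(∏ j, zα j) * zθ, ?_⟩
  unfold qEh
  rw [Fin.prod_univ_castSucc]
  unfold all
  simp only [Fin.snoc_castSucc, Fin.snoc_last]
  have hα' : ∏ j, ((((Q.α j).den : ℚ)) ^ (L j / 2 ^ J * s) * (Q.α j) ^ (Q.flat.expn u s (Fin.castSucc j) / 2)) =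
      ∏ j, (zα j : ℚ) :=
    prod_congr rfl fun j _ => by exact_mod_cast hzα j
  push_cast at hzθ ⊢
  calc (∏ j, (((Q.α j).den : ℚ)) ^ (L j / 2 ^ J * s)) * ((Q.θ.den : ℚ)) ^ (Lθ / 2 ^ J * s) *
        ((∏ j, Q.α j ^ (Q.flat.expn u s (Fin.castSucc j) / 2)) * Q.θ ^ (Q.flat.expn u s (Fin.last Q.d) / 2))
      = (∏ j, ((((Q.α j).den : ℚ)) ^ (L j / 2 ^ J * s) * (Q.α j) ^ (Q.flat.expn u s (Fin.castSucc j) / 2))) *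
          (((Q.θ.den : ℚ)) ^ (Lθ / 2 ^ J * s) * Q.θ ^ (Q.flat.expn u s (Fin.last Q.d) / 2)) := by
        rw [prod_mul_distrib]; ring
    _ = (∏ j, (zα j : ℚ)) * (zθ : ℚ) := by rw [hα', hzθ]

/-- The denominator part of `Dhalf♭` is that of the signed generators. [folklore] -/
theorem flat_Dhalf_eq (J₀ J : ℕ) (L : Fin Q.d → ℕ) (Lθ : ℕ) (s : ℕ) (τ : Tau Q.d) :
    Q.flat.Dhalf (h := h) J₀ J L Lθ s τ =
      nuBound (scale J₀ (J + 1) * s) h ^ τ.1 * Q.bθ.natAbs ^ (∑ j, τ.2 j) *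
        ((∏ j, (Q.α j).den ^ (L j / 2 ^ J * s)) * Q.θ.den ^ (Lθ / 2 ^ J * s)) := by
  unfold CW77.Setup.Dhalf
  simp only [Rat.den_abs_eq_den]

/-- **`Dhalf♭ · rHalf ∈ ℤ`** on the box of level `J` (signed). [folklore] -/
theorem exists_int_Dhalf_mul_rHalf (J₀ J : ℕ) {L : Fin Q.d → ℕ} {Lθ : ℕ} {u : Idx Q.d h Lb}
    (hu : u ∈ Q.flat.box (h := h) (Lb := Lb) L Lθ J) (τ : Tau Q.d) (s : ℕ) :
    ∃ z : ℤ, ((Q.flat.Dhalf (h := h) J₀ J L Lθ s τ : ℕ) : ℚ) * Q.rHalf J₀ J u τ s = z := by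
  obtain ⟨z₁, hz₁⟩ := Q.flat.exists_int_qΔ J₀ (J + 1) u τ.1 s
  obtain ⟨z₂, hz₂⟩ := Q.flat.exists_int_qA u τ.2
  obtain ⟨z₃, hz₃⟩ := Q.exists_int_qEh hu s
  refine ⟨z₁ * z₂ * z₃, ?_⟩
  rw [Q.flat_Dhalf_eq]
  unfold rHalf
  push_cast at hz₁ hz₂ hz₃ ⊢
  rw [← hz₁, ← hz₂, ← hz₃]; ring

/-- `Dhalf♭ · classVec(T') ∈ ℤ` (signed). [folklore] -/
theorem exists_int_Dhalf_mul_classVec (J₀ J : ℕ) (L : Fin Q.d → ℕ) (Lθ : ℕ) {p : Idx Q.d h Lb → ℤ}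
    (τ : Tau Q.d) (s : ℕ) (T' : Finset (Fin (Q.d + 1))) :
    ∃ z : ℤ, ((Q.flat.Dhalf (h := h) J₀ J L Lθ s τ : ℕ) : ℚ) *
      Q.classVec J₀ J (Q.flat.box (h := h) (Lb := Lb) L Lθ J) p τ s T' = z := by
  classical
  unfold classVec
  rw [mul_sum]
  have hterm : ∀ u ∈ (Q.flat.box (h := h) (Lb := Lb) L Lθ J).filter (fun u => Q.flat.Sset u s = T'),
      ∃ z : ℤ, ((Q.flat.Dhalf (h := h) J₀ J L Lθ s τ : ℕ) : ℚ) * ((p u : ℚ) * Q.rHalf J₀ J u τ s) = z := by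
    intro u hu
    obtain ⟨z, hz⟩ := Q.exists_int_Dhalf_mul_rHalf J₀ J (mem_filter.mp hu).1 τ s
    exact ⟨p u * z, by push_cast; rw [← hz]; ring⟩
  choose z hz using hterm
  refine ⟨∑ u ∈ ((Q.flat.box (h := h) (Lb := Lb) L Lθ J).filter (fun u => Q.flat.Sset u s = T')).attach,
    z u.1 u.2, ?_⟩
  push_cast
  rw [← sum_attach]
  exact sum_congr rfl fun u _ => hz u.1 u.2

end SetupQ

end Summit.ABC.StewartYu

end
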